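import Literature.Algebra.Lie.LefschetzModuleSelfAdjoint
import Literature.AlgebraicGeometry.Motives.HodgeStructureExteriorAlgebraLefschetzInvolution
import HarnessLib

/-!
# `*_L`, `∗`, `ᶜΛ`, `Λ` are self-adjoint for the top-degree (Poincaré) pairing of the exterior algebra of a symplectic space
# (André 1996, §1.1 remark; Prop. 1.2, last clause)

[topic AlgebraicGeometry/Motives]

Layer `Literature/AlgebraicGeometry/Motives`, lane `lit-hodgefound` (Track 2 foundations library; prover seat `lit-hodgefound-p34`,
generation 30, row g30-#4).  The READING of row g30-#3 (`Algebra/Lie/LefschetzModuleSelfAdjoint.lean`: on an abstract Lefschetz module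
with a pairing for which `h` is skew- and `e` self-adjoint, `*_L`, `*_H`, `ᶜΛ` are self-adjoint) on the Lefschetz module `(⋀ W, h, e_ω)`
of a non-degenerate 2-vector `ω` of genus `g` (rows g29-#1/#4: `shiftedDegree`, `lefschetzStar = *_L`, `hodgeStar = ∗`,
`lefschetzDual = ᶜΛ`) with its POINCARÉ PAIRING `(x, y) ↦ τ_ω(x ∧ y)` (`trace ω g`, Q454: the coefficient of `ω^g/g!` in top degree —
"`∫_X x ∪ y`").  PROVED theorems only (no definition, no named fact, no `sorry`, no instance, no notation; net debt `0`); the pairing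
is written `(LinearMap.mul K (⋀ W)).compr₂ (trace ω g)` where a bilinear form is needed and `trace ω g (x * y)` in the displayed
identities.

## Source, VERBATIM

Y. André, *Pour une théorie inconditionnelle des motifs*, Publ. Math. IHÉS **83** (1996) [Andre1996Motifs] (held
`paper:doi-10-1007-bf02698643`), §1.1 (p. 11 = p0008 L13–L14): "Remarquons aussi que `L`, `*_L`, `*_H` et `ᶜΛ` sont auto-adjoints
relativement à l'accouplement de dualité de Poincaré `(x, y) ↦ ∫ x ∪ y`."; Prop. 1.2 (p. 11 = p0008 L64–L66): "Via cet isomorphisme,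
la transposition relative à la forme bilinéaire `(x, y) ↦ ∫ x ∪ * y` correspond à la transposition des matrices, pour `* = *_L` ou
`*_H`."; proof (p. 12): "il suffit de la tester sur les générateurs `L` et `*_L L *_L`. Comme ces générateurs s'échangent par la
transposition, c'est clair."
J. S. Milne, *Lefschetz classes on abelian varieties*, Duke Math. J. **96** (1999) [Milne1999LefschetzClasses], p. 664 (`Λ`, `ᶜΛ`, `∗`).

## Contents (all proved; `𝒜 = fun i ↦ ⋀[K]^i W`)

* §1 the Poincaré pairing of `⋀ W`: `trace_mul_eq_zero_of_add_ne` (`τ(x ∧ y) = 0` for `x ∈ ⋀ᵃ`, `y ∈ ⋀ᵇ`, `a + b ≠ 2g`),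
  **`isSkewAdjoint_shiftedDegree_trace`** (`h` is skew: complementary degrees), **`isSelfAdjoint_mul_trace`** (`e_ω = ω ∧ ·` is
  self-adjoint for `ω ∈ ⋀² W` — "`L` […] auto-adjoint").
* §2 André's remark on `⋀ W` (`hω : IsSymplectic ω g`): **`IsSymplectic.trace_lefschetzStar_mul`** (`τ(*_L x ∧ y) = τ(x ∧ *_L y)`),
  **`IsSymplectic.trace_hodgeStar_mul`** (`∗`), **`IsSymplectic.trace_lefschetzDual_mul`** (`ᶜΛ`, `g ≥ 1`),
  `IsSymplectic.trace_conj_lefschetzStar_mul` (Milne's `Λ = *_L e_ω *_L`), the `IsSelfAdjoint` forms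
  `IsSymplectic.isSelfAdjoint_lefschetzStar_trace` / `…hodgeStar_trace` / `…lefschetzDual_trace`,
  **`IsSymplectic.exists_mem_adjoin_trace_mul_eq`** (`K[e_ω, ᶜΛ]` is stable under transposition for `τ`).
* §3 Prop. 1.2, last clause on `⋀ W`: `IsSymplectic.trace_mul_mul_hodgeStar` (`τ(ω ∧ x ∧ ∗y) = τ(x ∧ ∗((∗ e_ω ∗) y))`),
  `IsSymplectic.trace_mul_mul_lefschetzStar` (same with `*_L`); and the graded symmetry of `(x, y) ↦ τ(x ∧ ∗y)`:
  **`IsSymplectic.trace_mul_hodgeStar_swap`** (`τ(x ∧ ∗y) = (-1)ᵃ τ(y ∧ ∗x)` for `x, y ∈ ⋀ᵃ W` — symmetric in even degree (row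
  g29-#5 `Polarization.trace_mul_hodgeStar_symm` is the case `a = 2p ≤ g` on the Hodge-structure carrier), antisymmetric in odd degree),
  `IsSymplectic.trace_mul_lefschetzStar_swap`.

## References

* [Andre1996Motifs] Y. André, *Pour une théorie inconditionnelle des motifs*, Publ. Math. IHÉS 83 (1996), §1.1 (p. 11), Prop. 1.2
  (pp. 11–12).
* [Milne1999LefschetzClasses] J. S. Milne, *Lefschetz classes on abelian varieties*, Duke Math. J. 96 (1999), §5 p. 664.
* [BourbakiAlgebre1a3] N. Bourbaki, *Algèbre*, Ch. III §7 (graded commutativity of the exterior algebra).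
-/

noncomputable section

universe u v

namespace Literature.AlgebraicGeometry.Motives.ExteriorLefschetz

open Literature.Algebra.Lie ExteriorAlgebra Module Function Set
open Literature.Algebra.Lie.HasLefschetzProperty (primitiveSpace mem_primitiveSpace_iff)

variable {K : Type u} [Field K] [CharZero K] {W : Type v} [AddCommGroup W] [Module K W]
variable {ω : ExteriorAlgebra K W} {g : ℕ}

/-! ## §1 The Poincaré pairing `(x, y) ↦ τ_ω(x ∧ y)`: `h` is skew-adjoint, `e_ω` is self-adjoint -/

/-- `τ(x ∧ y) = 0` unless the degrees are complementary: `x ∈ ⋀ᵃ W`, `y ∈ ⋀ᵇ W`, `a + b ≠ 2g`. [cite: Andre1996Motifs, §1.1 (p. 11, "dualité de Poincaré")] -/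
theorem trace_mul_eq_zero_of_add_ne {a b : ℕ} {x y : ExteriorAlgebra K W} (hx : x ∈ ⋀[K]^a W) (hy : y ∈ ⋀[K]^b W)
    (hab : a + b ≠ 2 * g) : trace ω g (x * y) = 0 :=
  trace_apply_of_mem_ne (SetLike.mul_mem_graded hx hy) hab

/-- **The degree operator `h` is skew-adjoint for the Poincaré pairing** (`τ` pairs `⋀ᵃ W` with `⋀^{2g-a} W`, on which `h` acts by
`a - g` and `g - a`). [cite: Andre1996Motifs, §1.1 (p. 11, "l'accouplement de dualité de Poincaré")] -/
theorem isSkewAdjoint_shiftedDegree_trace (ω : ExteriorAlgebra K W) (g : ℕ) :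
    ((LinearMap.mul K (ExteriorAlgebra K W)).compr₂ (trace ω g)).IsSkewAdjoint
      ⇑(shiftedDegree K (fun i : ℕ ↦ ⋀[K]^i W) g) := by
  intro x y
  rw [LinearMap.compr₂_apply, LinearMap.compr₂_apply, LinearMap.mul_apply', LinearMap.mul_apply', Pi.neg_apply, mul_neg,
    map_neg]
  induction x using DirectSum.Decomposition.inductionOn (fun i : ℕ ↦ ⋀[K]^i W) with
  | zero => rw [map_zero, zero_mul, zero_mul, map_zero, neg_zero]
  | @homogeneous a x =>
    induction y using DirectSum.Decomposition.inductionOn (fun i : ℕ ↦ ⋀[K]^i W) with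
    | zero => rw [map_zero, mul_zero, mul_zero, map_zero, neg_zero]
    | @homogeneous b y =>
      rw [shiftedDegree_apply_of_mem_exteriorPower g x.2, shiftedDegree_apply_of_mem_exteriorPower g y.2, smul_mul_assoc,
        mul_smul_comm, map_smul, map_smul, smul_eq_mul, smul_eq_mul]
      by_cases hab : a + b = 2 * g
      · have hb : (b : K) - g = -((a : K) - g) := by
          have : (b : K) = 2 * (g : K) - a := by rw [← Nat.cast_ofNat, ← Nat.cast_mul, ← hab]; push_cast; ring
          rw [this]; ring
        rw [hb, neg_mul, neg_neg]
      · rw [trace_mul_eq_zero_of_add_ne x.2 y.2 hab, mul_zero, mul_zero, neg_zero]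
    | add y y' hy hy' => simp only [map_add, mul_add, hy, hy', neg_add]
  | add x x' hx hx' => simp only [map_add, add_mul, hx, hx', neg_add]

/-- **"`L` […] auto-adjoint": `τ(ω ∧ x ∧ y) = τ(x ∧ ω ∧ y)`** for `ω ∈ ⋀² W` (even elements are central).
[cite: Andre1996Motifs, §1.1 (p. 11)] -/
theorem isSelfAdjoint_mul_trace (hω : ω ∈ ⋀[K]^2 W) (ω' : ExteriorAlgebra K W) (g : ℕ) :
    ((LinearMap.mul K (ExteriorAlgebra K W)).compr₂ (trace ω' g)).IsSelfAdjoint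
      ⇑(LinearMap.mul K (ExteriorAlgebra K W) ω) := by
  intro x y
  rw [LinearMap.compr₂_apply, LinearMap.compr₂_apply, LinearMap.mul_apply', LinearMap.mul_apply', LinearMap.mul_apply',
    LinearMap.mul_apply', ← mul_assoc x ω y, ← mul_comm_of_mem_two hω x, mul_assoc]

/-! ## §2 `*_L`, `∗`, `ᶜΛ`, `Λ` are self-adjoint for `τ` -/

/-- **"`*_L` […] auto-adjoint": `τ(*_L x ∧ y) = τ(x ∧ *_L y)`.** [cite: Andre1996Motifs, §1.1 (p. 11)] -/
theorem IsSymplectic.isSelfAdjoint_lefschetzStar_trace (hω : IsSymplectic ω g) :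
    ((LinearMap.mul K (ExteriorAlgebra K W)).compr₂ (trace ω g)).IsSelfAdjoint ⇑(lefschetzStar ω g) := by
  haveI := hω.finiteDimensional_exteriorAlgebra
  rw [hω.lefschetzStar_eq]
  exact hω.hasLefschetzProperty_mul.isSelfAdjoint_lefschetzInvolution _ (isSkewAdjoint_shiftedDegree_trace ω g)
    (isSelfAdjoint_mul_trace hω.mem ω g)

/-- Displayed form: `τ(*_L x ∧ y) = τ(x ∧ *_L y)`. [cite: Andre1996Motifs, §1.1 (p. 11)] -/
theorem IsSymplectic.trace_lefschetzStar_mul (hω : IsSymplectic ω g) (x y : ExteriorAlgebra K W) :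
    trace ω g (lefschetzStar ω g x * y) = trace ω g (x * lefschetzStar ω g y) := by
  have h1 := hω.isSelfAdjoint_lefschetzStar_trace x y
  simpa only [LinearMap.compr₂_apply, LinearMap.mul_apply'] using h1

/-- **"`*_H` […] auto-adjoint": `∗` is self-adjoint for `τ`.** [cite: Andre1996Motifs, §1.1 (p. 11)] [cite: Milne1999LefschetzClasses, §5 p. 664] -/
theorem IsSymplectic.isSelfAdjoint_hodgeStar_trace (hω : IsSymplectic ω g) :
    ((LinearMap.mul K (ExteriorAlgebra K W)).compr₂ (trace ω g)).IsSelfAdjoint ⇑(hodgeStar ω g) := by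
  haveI := hω.finiteDimensional_exteriorAlgebra
  rw [hω.hodgeStar_eq]
  exact hω.hasLefschetzProperty_mul.isSelfAdjoint_hodgeInvolution _ g (isSkewAdjoint_shiftedDegree_trace ω g)
    (isSelfAdjoint_mul_trace hω.mem ω g)

/-- Displayed form: `τ(∗x ∧ y) = τ(x ∧ ∗y)`. [cite: Andre1996Motifs, §1.1 (p. 11)] [cite: Milne1999LefschetzClasses, §5 p. 664] -/
theorem IsSymplectic.trace_hodgeStar_mul (hω : IsSymplectic ω g) (x y : ExteriorAlgebra K W) :
    trace ω g (hodgeStar ω g x * y) = trace ω g (x * hodgeStar ω g y) := by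
  have h1 := hω.isSelfAdjoint_hodgeStar_trace x y
  simpa only [LinearMap.compr₂_apply, LinearMap.mul_apply'] using h1

/-- **"`ᶜΛ` […] auto-adjoint": `Λ_ω = ᶜΛ` is self-adjoint for `τ`** (`g ≥ 1`). [cite: Andre1996Motifs, §1.1 (p. 11)] [cite: Milne1999LefschetzClasses, §5 p. 664] -/
theorem IsSymplectic.isSelfAdjoint_lefschetzDual_trace (hω : IsSymplectic ω g) (hg : 0 < g) :
    ((LinearMap.mul K (ExteriorAlgebra K W)).compr₂ (trace ω g)).IsSelfAdjoint ⇑(lefschetzDual ω g) := by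
  haveI := hω.finiteDimensional_exteriorAlgebra
  rw [← hω.dual_eq_lefschetzDual hg]
  exact hω.hasLefschetzProperty_mul.isSelfAdjoint_dual _ (isSkewAdjoint_shiftedDegree_trace ω g)
    (isSelfAdjoint_mul_trace hω.mem ω g)

/-- Displayed form: `τ(ᶜΛ x ∧ y) = τ(x ∧ ᶜΛ y)`. [cite: Andre1996Motifs, §1.1 (p. 11)] -/
theorem IsSymplectic.trace_lefschetzDual_mul (hω : IsSymplectic ω g) (hg : 0 < g) (x y : ExteriorAlgebra K W) :
    trace ω g (lefschetzDual ω g x * y) = trace ω g (x * lefschetzDual ω g y) := by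
  have h1 := hω.isSelfAdjoint_lefschetzDual_trace hg x y
  simpa only [LinearMap.compr₂_apply, LinearMap.mul_apply'] using h1

/-- Milne's `Λ = *_L e_ω *_L` ("inverse to `L`") is self-adjoint for `τ`: `τ(Λ x ∧ y) = τ(x ∧ Λ y)`.
[cite: Andre1996Motifs, §1.1 (p. 11, "l'opérateur *_L L *_L")] [cite: Milne1999LefschetzClasses, §5 p. 664] -/
theorem IsSymplectic.trace_conj_lefschetzStar_mul (hω : IsSymplectic ω g) (x y : ExteriorAlgebra K W) :
    trace ω g ((lefschetzStar ω g * LinearMap.mul K (ExteriorAlgebra K W) ω * lefschetzStar ω g) x * y) =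
      trace ω g (x * (lefschetzStar ω g * LinearMap.mul K (ExteriorAlgebra K W) ω * lefschetzStar ω g) y) := by
  haveI := hω.finiteDimensional_exteriorAlgebra
  have h1 := hω.hasLefschetzProperty_mul.isSelfAdjoint_conj_lefschetzInvolution
    (isZGrading_shiftedDegree K (fun i : ℕ ↦ ⋀[K]^i W) g) (isSkewAdjoint_shiftedDegree_trace ω g)
    (isSelfAdjoint_mul_trace hω.mem ω g) x y
  rw [← hω.lefschetzStar_eq] at h1
  simpa only [LinearMap.compr₂_apply, LinearMap.mul_apply'] using h1

/-- **`K[e_ω, ᶜΛ]` is stable under transposition for `τ`**: every `T ∈ K[e_ω, ᶜΛ]` has a `T' ∈ K[e_ω, ᶜΛ]` with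
`τ(T x ∧ y) = τ(x ∧ T' y)` (`g ≥ 1`). [cite: Andre1996Motifs, §1.1 (p. 11) and Prop. 1.2 (p. 11)] -/
theorem IsSymplectic.exists_mem_adjoin_trace_mul_eq (hω : IsSymplectic ω g) (hg : 0 < g) {T : Module.End K (ExteriorAlgebra K W)}
    (hT : T ∈ Algebra.adjoin K ({LinearMap.mul K (ExteriorAlgebra K W) ω, lefschetzDual ω g} : Set (Module.End K (ExteriorAlgebra K W)))) :
    ∃ T' ∈ Algebra.adjoin K ({LinearMap.mul K (ExteriorAlgebra K W) ω, lefschetzDual ω g} : Set (Module.End K (ExteriorAlgebra K W))),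
      ∀ x y : ExteriorAlgebra K W, trace ω g (T x * y) = trace ω g (x * T' y) := by
  haveI := hω.finiteDimensional_exteriorAlgebra
  rw [← hω.dual_eq_lefschetzDual hg] at hT ⊢
  obtain ⟨T', hT', hTT'⟩ := hω.hasLefschetzProperty_mul.exists_isAdjointPair_of_mem_adjoin_pair_dual _
    (isSkewAdjoint_shiftedDegree_trace ω g) (isSelfAdjoint_mul_trace hω.mem ω g) hT
  refine ⟨T', hT', fun x y ↦ ?_⟩
  have h1 := hTT' x y
  simpa only [LinearMap.compr₂_apply, LinearMap.mul_apply'] using h1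

/-! ## §3 Prop. 1.2, last clause: for `(x, y) ↦ τ(x ∧ * y)`, `L` and `* L *` are transposes; graded symmetry of that form -/

/-- **"ces générateurs [`L`, `∗ L ∗`] s'échangent par la transposition" relative to `(x, y) ↦ τ(x ∧ ∗y)`**:
`τ(ω ∧ x ∧ ∗y) = τ(x ∧ ∗((∗ e_ω ∗) y))`. [cite: Andre1996Motifs, Prop. 1.2 (p. 11) and its proof (p. 12)] -/
theorem IsSymplectic.trace_mul_mul_hodgeStar (hω : IsSymplectic ω g) (x y : ExteriorAlgebra K W) :
    trace ω g (ω * x * hodgeStar ω g y) =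
      trace ω g (x * hodgeStar ω g ((hodgeStar ω g * LinearMap.mul K (ExteriorAlgebra K W) ω * hodgeStar ω g) y)) := by
  haveI := hω.finiteDimensional_exteriorAlgebra
  have h1 := hω.hasLefschetzProperty_mul.isAdjointPair_compl₂_hodgeInvolution
    (isZGrading_shiftedDegree K (fun i : ℕ ↦ ⋀[K]^i W) g) g (B := (LinearMap.mul K (ExteriorAlgebra K W)).compr₂ (trace ω g))
    (isSelfAdjoint_mul_trace hω.mem ω g) x y
  rw [← hω.hodgeStar_eq] at h1
  simpa only [LinearMap.compl₂_apply, LinearMap.compr₂_apply, LinearMap.mul_apply'] using h1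

/-- The same for `*_L`: `τ(ω ∧ x ∧ *_L y) = τ(x ∧ *_L ((*_L e_ω *_L) y))`. [cite: Andre1996Motifs, Prop. 1.2 (p. 11, "pour * = *_L ou *_H")] -/
theorem IsSymplectic.trace_mul_mul_lefschetzStar (hω : IsSymplectic ω g) (x y : ExteriorAlgebra K W) :
    trace ω g (ω * x * lefschetzStar ω g y) =
      trace ω g (x * lefschetzStar ω g ((lefschetzStar ω g * LinearMap.mul K (ExteriorAlgebra K W) ω * lefschetzStar ω g) y)) := by
  haveI := hω.finiteDimensional_exteriorAlgebra
  have h1 := hω.hasLefschetzProperty_mul.isAdjointPair_compl₂_lefschetzInvolution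
    (isZGrading_shiftedDegree K (fun i : ℕ ↦ ⋀[K]^i W) g) (B := (LinearMap.mul K (ExteriorAlgebra K W)).compr₂ (trace ω g))
    (isSelfAdjoint_mul_trace hω.mem ω g) x y
  rw [← hω.lefschetzStar_eq] at h1
  simpa only [LinearMap.compl₂_apply, LinearMap.compr₂_apply, LinearMap.mul_apply'] using h1

/-- **Graded symmetry of `(x, y) ↦ τ(x ∧ ∗y)`**: for `x, y ∈ ⋀ᵃ W`, `τ(x ∧ ∗y) = (-1)ᵃ τ(y ∧ ∗x)` (`∗` is self-adjoint and
`∗x ∈ ⋀^{2g-a} W` commutes with `y` up to `(-1)^{a(2g-a)} = (-1)ᵃ`). [cite: Andre1996Motifs, §1.1 (p. 11) and Prop. 1.2 (p. 11)]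
[cite: BourbakiAlgebre1a3, Ch. III §7 no. 1] -/
theorem IsSymplectic.trace_mul_hodgeStar_swap (hω : IsSymplectic ω g) {a : ℕ} {x y : ExteriorAlgebra K W} (hx : x ∈ ⋀[K]^a W)
    (hy : y ∈ ⋀[K]^a W) : trace ω g (x * hodgeStar ω g y) = ((-1 : K) ^ a) • trace ω g (y * hodgeStar ω g x) := by
  by_cases ha : a ≤ 2 * g
  · have hsx : hodgeStar ω g x ∈ ⋀[K]^(2 * g - a) W := hω.hodgeStar_apply_mem (by omega) hx
    rw [← hω.trace_hodgeStar_mul, mul_comm_of_mem hsx hy, map_smul]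
    congr 1
    rcases Nat.even_or_odd a with ⟨r, hr⟩ | ⟨r, hr⟩
    · rw [hr, show (2 * g - (r + r)) * (r + r) = 2 * ((2 * g - (r + r)) * r) by ring, pow_mul, neg_one_sq, one_pow,
        show r + r = 2 * r by ring, pow_mul, neg_one_sq, one_pow]
    · have h1 : (2 * g - a) * a = 2 * (((2 * g - a) * a) / 2) + 1 := by
        have hodd : Odd ((2 * g - a) * a) := Nat.odd_mul.2 ⟨by rw [hr]; exact ⟨g - r - 1, by omega⟩, ⟨r, hr⟩⟩
        obtain ⟨m, hm⟩ := hodd; omega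
      rw [h1, pow_succ, pow_mul, neg_one_sq, one_pow, one_mul, hr, pow_succ, pow_mul, neg_one_sq, one_pow, one_mul]
  · -- beyond the top degree everything vanishes
    have hx0 : x = 0 := by
      have := hω.exteriorPower_eq_bot_of_lt a (by omega); rw [this] at hx; simpa using hx
    have hy0 : y = 0 := by
      have := hω.exteriorPower_eq_bot_of_lt a (by omega); rw [this] at hy; simpa using hy
    rw [hx0, hy0, zero_mul, map_zero, smul_zero]

/-- The same for `*_L`: `τ(x ∧ *_L y) = (-1)ᵃ τ(y ∧ *_L x)` for `x, y ∈ ⋀ᵃ W`. [cite: Andre1996Motifs, §1.1 (p. 11) and Prop. 1.2 (p. 11)]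
[cite: BourbakiAlgebre1a3, Ch. III §7 no. 1] -/
theorem IsSymplectic.trace_mul_lefschetzStar_swap (hω : IsSymplectic ω g) {a : ℕ} {x y : ExteriorAlgebra K W} (hx : x ∈ ⋀[K]^a W)
    (hy : y ∈ ⋀[K]^a W) : trace ω g (x * lefschetzStar ω g y) = ((-1 : K) ^ a) • trace ω g (y * lefschetzStar ω g x) := by
  by_cases ha : a ≤ 2 * g
  · have hsx : lefschetzStar ω g x ∈ ⋀[K]^(2 * g - a) W := hω.lefschetzStar_apply_mem (by omega) hx
    rw [← hω.trace_lefschetzStar_mul, mul_comm_of_mem hsx hy, map_smul]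
    congr 1
    rcases Nat.even_or_odd a with ⟨r, hr⟩ | ⟨r, hr⟩
    · rw [hr, show (2 * g - (r + r)) * (r + r) = 2 * ((2 * g - (r + r)) * r) by ring, pow_mul, neg_one_sq, one_pow,
        show r + r = 2 * r by ring, pow_mul, neg_one_sq, one_pow]
    · have h1 : (2 * g - a) * a = 2 * (((2 * g - a) * a) / 2) + 1 := by
        have hodd : Odd ((2 * g - a) * a) := Nat.odd_mul.2 ⟨by rw [hr]; exact ⟨g - r - 1, by omega⟩, ⟨r, hr⟩⟩
        obtain ⟨m, hm⟩ := hodd; omega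
      rw [h1, pow_succ, pow_mul, neg_one_sq, one_pow, one_mul, hr, pow_succ, pow_mul, neg_one_sq, one_pow, one_mul]
  · have hx0 : x = 0 := by
      have := hω.exteriorPower_eq_bot_of_lt a (by omega); rw [this] at hx; simpa using hx
    have hy0 : y = 0 := by
      have := hω.exteriorPower_eq_bot_of_lt a (by omega); rw [this] at hy; simpa using hy
    rw [hx0, hy0, zero_mul, map_zero, smul_zero]

end Literature.AlgebraicGeometry.Motives.ExteriorLefschetz

end
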